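import Mathlib
import Literature.Computability.AlgebraicComplexity.StandardFamilies
import Summits.ValiantsHypothesis.ValiantsHypothesis.Theorems.ChowBorderDepth3LocalFanInTwoFlattening
import Summits.ValiantsHypothesis.ValiantsHypothesis.Theorems.ChowBorderDepth3LocalFanInTwoPermMinor
import Summits.ValiantsHypothesis.ValiantsHypothesis.Theorems.BinomialElusiveBinomialCandidateAffinePeeling

/-!
# Padded flattenings: `C(n,k)² ≤ r · C(D,k)` for every border `σ_r(Ch_D)`-expression of `per_n`
# (the flattening rung of crux `ChowBorderDepth3.ChowBorderBound`, stmt-ValiantsHypothesis-5936)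

Support file (`--supports stmt-ValiantsHypothesis-5936`) of route `ValiantsHypothesis/ChowBorderDepth3`.
The crux forbids, for `r, D ≤ (n+2)^(c⌊√n⌋+c)`, border expressions
`Σ_{i<r} Π_{j<D} ℓ_ij(ε) = ε^q · per_n + ε^(q+1) · G` with affine `ℓ_ij` over `ℂ[ε]` (the padded
permanent outside `σ_r(Ch_D(ℂ^(n²+1)))`, Landsberg 2017 Cor. 7.5.3.3).  This file proves the one
inequality the method of partial derivatives (flattenings) yields against such an expression, for
EVERY `r, D, q`: `choose_sq_le_mul_choose_of_border : ∀ k ≤ n, C(n,k)² ≤ r · C(D,k)`.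

Mechanism (Nisan–Wigderson 1996/97 §3; Landsberg 2017 §6.2, §7.2): every order-`k` derivative of
a product of `D` AFFINE forms lies in the span of the `C(D,k)` sub-products `Π_{j ∉ S} ℓ_j`,
`|S| = k` (`iterD_coProd_mem_span`), so the flattening matrix of the left side with column words
of length `k` factors through `ℂ[ε]^(r·C(D,k))` (`flattening_sum_prod_affine_eq_mul`); the same
minor of the right side is `ε^(qN)` times a polynomial whose constant term is the corresponding
minor of `per_n`, which has an identity minor of size `N = C(n,k)²`
(`exists_perPoly_flattening_len`); border semicontinuity = passage to the constant term
(`card_le_of_border_chow`).  Consequences: `n ≤ D`, `1 ≤ r` (`k = n`), `n² ≤ r·D` (`k = 1`).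
Since `max_k C(n,k)²/C(D,k) ≈ exp(e·n²/D)`, no `k` beats `(n+2)^(c√n)` once `D ≳ n^(3/2)/log n`:
the quantitative form, for this crux, of the barrier `PartialDerivativesDetPerm`.

References: N. Nisan, A. Wigderson, Comput. Complexity 6 (1996/97) §3; J. M. Landsberg,
*Geometry and complexity theory*, CUP 2017, §6.2, §7.2, Cor. 7.5.3.3.
-/


noncomputable section

-- `Summit.ValiantsHypothesis.ValiantsHypothesis.…` is the tree's mandated single-conjunct layout
-- (Sub = Summit), so the duplicated namespace component is intended.
set_option linter.dupNamespace false

namespace Summit.ValiantsHypothesis.ValiantsHypothesis.Theorems.ChowBorderBound.PaddedFlattening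

open MvPolynomial Literature.Computability.AlgebraicComplexity
open Summit.ValiantsHypothesis.ValiantsHypothesis.Theorems.ChowBorderDepth3LocalFanInTwo
open scoped Polynomial

/-! ## §1 Derivatives of products of affine forms stay in the span of the sub-products -/
section Affine

variable {σ R : Type*} [CommRing R]

/-- The partial derivative of an AFFINE polynomial (`totalDegree ≤ 1`) is the constant
`coeff (e_v) f`. [folklore] -/
theorem pderiv_eq_C_of_totalDegree_le_one [Fintype σ] [DecidableEq σ] (f : MvPolynomial σ R)
    (hf : f.totalDegree ≤ 1) (v : σ) :
    pderiv v f = C (f.coeff (Finsupp.single v 1)) := by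
  conv_lhs =>
    rw [Summit.ValiantsHypothesis.ValiantsHypothesis.Theorems.BinomialCandidateStubs.AffinePeeling.eq_affine_of_totalDegree_le_one
      f hf]
  rw [map_add, pderiv_C, zero_add, pderiv_linearForm]

/-- **Leibniz rule over a finite product**: `∂_v (Π_{j∈s} Q_j) = Σ_{j∈s} (Π_{j'≠j} Q_{j'}) · ∂_v Q_j`.
[folklore] -/
theorem pderiv_finset_prod {ι : Type*} [DecidableEq ι] (v : σ) (s : Finset ι)
    (Q : ι → MvPolynomial σ R) :
    pderiv v (∏ j ∈ s, Q j) = ∑ j ∈ s, (∏ j' ∈ s.erase j, Q j') * pderiv v (Q j) := by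
  induction s using Finset.induction_on with
  | empty => simp
  | insert a s ha ih =>
    rw [Finset.prod_insert ha, pderiv_mul, ih, Finset.sum_insert ha, Finset.erase_insert ha,
      Finset.mul_sum]
    congr 1
    · ring
    · refine Finset.sum_congr rfl fun j hj => ?_
      have hne : a ≠ j := fun h => ha (h ▸ hj)
      rw [Finset.erase_insert_of_ne hne,
        Finset.prod_insert (fun h => ha (Finset.mem_of_mem_erase h))]
      ring

variable {D : ℕ}

/-- One derivative of a co-product `Π_{t ∉ S} ℓ_t` of affine forms (`|S| = m`) lies in the span of
the co-products `Π_{t ∉ S'} ℓ_t` with `|S'| = m + 1`. [cite: LandsbergGCT2017, §7.2] -/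
theorem pderiv_coProd_mem_span [Fintype σ] [DecidableEq σ] (ℓ : Fin D → MvPolynomial σ R)
    (hℓ : ∀ t, (ℓ t).totalDegree ≤ 1) (v : σ) (m : ℕ) (S : Finset (Fin D)) (hS : S.card = m) :
    pderiv v (∏ t ∈ Sᶜ, ℓ t) ∈
      Submodule.span R (Set.range fun S' : ↥(Finset.powersetCard (m + 1)
        (Finset.univ : Finset (Fin D))) => ∏ t ∈ (↑S' : Finset (Fin D))ᶜ, ℓ t) := by
  rw [pderiv_finset_prod]
  refine Submodule.sum_mem _ fun t ht => ?_
  rw [pderiv_eq_C_of_totalDegree_le_one (ℓ t) (hℓ t), mul_comm, ← smul_eq_C_mul]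
  refine Submodule.smul_mem _ _ (Submodule.subset_span ?_)
  have htS : t ∉ S := Finset.mem_compl.1 ht
  refine ⟨⟨insert t S, ?_⟩, ?_⟩
  · rw [Finset.mem_powersetCard]
    exact ⟨Finset.subset_univ _, by rw [Finset.card_insert_of_notMem htS, hS]⟩
  · simp only [Finset.compl_insert]

/-- **Iterated derivatives of a co-product of affine forms** `∂_w (Π_{t ∉ S} ℓ_t)` (`|S| = m`) lie
in the span of the co-products `Π_{t ∉ S'} ℓ_t`, `|S'| = m + |w|`. [cite: LandsbergGCT2017, §7.2] -/
theorem iterD_coProd_mem_span [Fintype σ] [DecidableEq σ] (ℓ : Fin D → MvPolynomial σ R)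
    (hℓ : ∀ t, (ℓ t).totalDegree ≤ 1) (w : List σ) :
    ∀ (m : ℕ) (S : Finset (Fin D)), S.card = m →
      w.foldr (fun v g => pderiv v g) (∏ t ∈ Sᶜ, ℓ t) ∈
        Submodule.span R (Set.range fun S' : ↥(Finset.powersetCard (m + w.length)
          (Finset.univ : Finset (Fin D))) => ∏ t ∈ (↑S' : Finset (Fin D))ᶜ, ℓ t) := by
  induction w with
  | nil =>
    intro m S hS
    refine Submodule.subset_span ⟨⟨S, ?_⟩, rfl⟩
    rw [Finset.mem_powersetCard]
    exact ⟨Finset.subset_univ _, by rw [hS, List.length_nil, add_zero]⟩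
  | cons v w ih =>
    intro m S hS
    rw [List.foldr_cons, List.length_cons, ← add_assoc]
    -- `∂_v` maps the span at level `m + |w|` into the span at level `m + |w| + 1`
    have key : Submodule.span R (Set.range fun S' : ↥(Finset.powersetCard (m + w.length)
          (Finset.univ : Finset (Fin D))) => ∏ t ∈ (↑S' : Finset (Fin D))ᶜ, ℓ t) ≤
        Submodule.comap (pderiv v).toLinearMap
          (Submodule.span R (Set.range fun S' : ↥(Finset.powersetCard (m + w.length + 1)
            (Finset.univ : Finset (Fin D))) => ∏ t ∈ (↑S' : Finset (Fin D))ᶜ, ℓ t)) := by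
      rw [Submodule.span_le]
      rintro _ ⟨S', rfl⟩
      rw [SetLike.mem_coe, Submodule.mem_comap]
      exact pderiv_coProd_mem_span ℓ hℓ v (m + w.length) S'
        (Finset.mem_powersetCard.1 S'.2).2
    exact key (ih m S hS)

/-- `∂_w (Π_t ℓ_t)` is an `R`-combination of the `C(D,|w|)` co-products `Π_{t ∉ S'} ℓ_t`,
`|S'| = |w|`. [cite: LandsbergGCT2017, §7.2] -/
theorem exists_iterD_prod_affine_eq_sum [Fintype σ] [DecidableEq σ] (ℓ : Fin D → MvPolynomial σ R)
    (hℓ : ∀ t, (ℓ t).totalDegree ≤ 1) (w : List σ) (m : ℕ) (hw : w.length = m) :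
    ∃ c : ↥(Finset.powersetCard m (Finset.univ : Finset (Fin D))) → R,
      w.foldr (fun v g => pderiv v g) (∏ t, ℓ t) =
        ∑ S', c S' • ∏ t ∈ (↑S' : Finset (Fin D))ᶜ, ℓ t := by
  have h := iterD_coProd_mem_span ℓ hℓ w 0 ∅ Finset.card_empty
  rw [Finset.compl_empty, zero_add, hw] at h
  obtain ⟨c, hc⟩ := (Submodule.mem_span_range_iff_exists_fun R).1 h
  exact ⟨c, hc.symm⟩

end Affine

/-! ## §2 The flattening of a sum of `r` products of `D` affine forms factors through `R^(r·C(D,k))` -/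

section Factor

variable {σ R ρ : Type*} [CommRing R] [Fintype σ] [DecidableEq σ] {r D : ℕ}

/-- **Factorisation.**  For words `β j` of common length `m`, the flattening matrix
`(coeff 0 (∂_{α i ++ β j} Σ_{s<r} Π_{t<D} ℓ_st))_{i,j}` of a sum of `r` products of `D` affine
forms is a product `A * B` through the index set `Fin r × {S ⊆ [D] : |S| = m}` of size
`r · C(D,m)`. [cite: LandsbergGCT2017, §7.2] -/
theorem flattening_sum_prod_affine_eq_mul (ℓ : Fin r → Fin D → MvPolynomial σ R)
    (hℓ : ∀ s t, (ℓ s t).totalDegree ≤ 1) (α β : ρ → List σ) (m : ℕ)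
    (hβ : ∀ j, (β j).length = m) :
    ∃ (A : Matrix ρ (Fin r × ↥(Finset.powersetCard m (Finset.univ : Finset (Fin D)))) R)
      (B : Matrix (Fin r × ↥(Finset.powersetCard m (Finset.univ : Finset (Fin D)))) ρ R),
      (Matrix.of fun i j => coeff 0 ((α i ++ β j).foldr (fun v g => pderiv v g)
        (∑ s, ∏ t, ℓ s t))) = A * B := by
  have hc : ∀ s j, ∃ c : ↥(Finset.powersetCard m (Finset.univ : Finset (Fin D))) → R,
      (β j).foldr (fun v g => pderiv v g) (∏ t, ℓ s t) =
        ∑ S', c S' • ∏ t ∈ (↑S' : Finset (Fin D))ᶜ, ℓ s t :=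
    fun s j => exists_iterD_prod_affine_eq_sum (ℓ s) (hℓ s) (β j) m (hβ j)
  choose c hc using hc
  refine ⟨Matrix.of fun i p => coeff 0 ((α i).foldr (fun v g => pderiv v g)
      (∏ t ∈ (↑p.2 : Finset (Fin D))ᶜ, ℓ p.1 t)), Matrix.of fun p j => c p.1 j p.2, ?_⟩
  ext i j
  simp only [Matrix.of_apply, Matrix.mul_apply, List.foldr_append, iterD_sum, hc,
    smul_eq_C_mul, iterD_C_mul, coeff_sum, coeff_C_mul, Fintype.sum_prod_type]
  refine Finset.sum_congr rfl fun s _ => Finset.sum_congr rfl fun S' _ => ?_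
  ring

end Factor

/-! ## §3 Border transfer: a non-zero flattening minor of `f` bounds `r · C(D,m)` from below -/
section Border

variable {σ ρ : Type*} [Fintype σ] [DecidableEq σ] [Fintype ρ] [DecidableEq ρ] {r D : ℕ}

/-- **Border products of affine forms have small flattenings.**  If
`Σ_{s<r} Π_{t<D} ℓ_st(ε) = ε^γ · Q(ε)` over `ℂ[ε]` (affine `ℓ_st`, `Q(0) = a · f`, `a ≠ 0`) and a
`ρ × ρ` flattening minor of `f` with column words of length `m` is non-zero, then
`|ρ| ≤ r · C(D,m)`. [cite: LandsbergGCT2017, §6.2, §7.2] -/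
theorem card_le_of_border_chow (ℓ : Fin r → Fin D → MvPolynomial σ ℂ[X])
    (hℓ : ∀ s t, (ℓ s t).totalDegree ≤ 1) {γ : ℕ} (Q : MvPolynomial σ ℂ[X])
    (f : MvPolynomial σ ℂ) (a : ℂ) (ha : a ≠ 0)
    (hsum : ∑ s, ∏ t, ℓ s t = C (Polynomial.X ^ γ) * Q)
    (hQ : MvPolynomial.map Polynomial.constantCoeff Q = C a * f)
    (α β : ρ → List σ) (m : ℕ) (hβ : ∀ j, (β j).length = m)
    (hdet : (Matrix.of fun i j =>
      coeff 0 ((α i ++ β j).foldr (fun v g => pderiv v g) f)).det ≠ 0) :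
    Fintype.card ρ ≤ r * D.choose m := by
  by_contra hlt
  rw [not_le] at hlt
  have hcard : Fintype.card (Fin r × ↥(Finset.powersetCard m (Finset.univ : Finset (Fin D)))) =
      r * D.choose m := by
    rw [Fintype.card_prod, Fintype.card_fin, Fintype.card_coe, Finset.card_powersetCard,
      Finset.card_univ, Fintype.card_fin]
  -- the flattening of the left side is singular
  have hzero : (Matrix.of fun i j => coeff 0 ((α i ++ β j).foldr (fun v g => pderiv v g)
      (C (Polynomial.X ^ γ) * Q))).det = 0 := by
    obtain ⟨A, B, hAB⟩ := flattening_sum_prod_affine_eq_mul ℓ hℓ α β m hβ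
    rw [← hsum, hAB]
    exact det_mul_eq_zero_of_card_lt A B (hcard ▸ hlt)
  -- but it is `ε^{γ|ρ|}` times a determinant that is `a^{|ρ|} det ≠ 0` at `ε = 0`
  rw [flattening_C_mul, Matrix.det_smul, mul_eq_zero] at hzero
  rcases hzero with h | h
  · exact pow_ne_zero _ (pow_ne_zero _ Polynomial.X_ne_zero) h
  · have h0 := congrArg Polynomial.constantCoeff h
    rw [RingHom.map_det, RingHom.mapMatrix_apply, flattening_map, hQ, flattening_C_mul,
      Matrix.det_smul, map_zero, mul_eq_zero] at h0
    rcases h0 with h0 | h0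
    · exact pow_ne_zero _ ha h0
    · exact hdet h0

end Border

/-! ## §4 The permanental identity minor, with the word lengths recorded -/
section PermMinor

variable {n : ℕ}

/-- **An identity minor of size `C(n,k)²` in the order-`k` flattening of the permanent**, as the
tree's `exists_perPoly_flattening` but recording the word lengths `|α i| = k`, `|β j| = n - k`
(needed by the padded count). [cite: LandsbergGCT2017, §6.2] -/
theorem exists_perPoly_flattening_len (n k : ℕ) :
    ∃ (N : ℕ) (α β : Fin N → List (Fin n × Fin n)), N = (n.choose k) ^ 2 ∧
      (∀ i, (α i).length = k) ∧ (∀ j, (β j).length = n - k) ∧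
      (Matrix.of fun i j => coeff 0 ((α i ++ β j).foldr (fun v g => pderiv v g)
        (perPoly (Fin n) ℂ))).det ≠ 0 := by
  classical
  -- adapted from the tree file `ChowBorderDepth3LocalFanInTwoPermMinor` (same construction)
  set P : Finset (Finset (Fin n)) := Finset.powersetCard k Finset.univ with hP
  have hmemP : ∀ {S : Finset (Fin n)}, S ∈ P → S.card = k := fun h =>
    (Finset.mem_powersetCard.1 h).2
  have hperm : ∀ p : P × P, ∃ π : Equiv.Perm (Fin n),
      ∀ j, π j ∈ (p.1 : Finset (Fin n)) ↔ j ∈ (p.2 : Finset (Fin n)) := by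
    rintro ⟨⟨S, hS⟩, ⟨T, hT⟩⟩
    exact exists_perm_mem_iff S T ((hmemP hS).trans (hmemP hT).symm)
  choose π hπ using hperm
  let α : P × P → List (Fin n × Fin n) := fun p =>
    (p.2 : Finset (Fin n)).toList.map fun j => (π p j, j)
  let β : P × P → List (Fin n × Fin n) := fun p =>
    ((p.2 : Finset (Fin n))ᶜ).toList.map fun j => (π p j, j)
  have hcard : Fintype.card (P × P) = (n.choose k) ^ 2 := by
    rw [Fintype.card_prod, Fintype.card_coe, hP, Finset.card_powersetCard, Finset.card_univ,
      Fintype.card_fin, sq]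
  have hword : ∀ p p' : P × P, ((α p ++ β p').map fun v => Finsupp.single v (1 : ℕ)).sum =
      ∑ j ∈ (p.2 : Finset (Fin n)), Finsupp.single (π p j, j) 1 +
        ∑ j ∈ (p'.2 : Finset (Fin n))ᶜ, Finsupp.single (π p' j, j) 1 := by
    intro p p'
    simp only [α, β, List.map_append, List.sum_append, List.map_map, Function.comp_def,
      Finset.sum_map_toList]
  have hM : (Matrix.of fun p p' => coeff 0 ((α p ++ β p').foldr (fun v g => pderiv v g)
      (perPoly (Fin n) ℂ))) = 1 := by
    ext p p'
    rw [Matrix.of_apply, Matrix.one_apply]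
    by_cases hpp : p = p'
    · subst hpp
      rw [if_pos rfl]
      have hnd : (α p ++ β p).Nodup := by
        have hlist : α p ++ β p = ((p.2 : Finset (Fin n)).toList ++
            ((p.2 : Finset (Fin n))ᶜ).toList).map (fun j => (π p j, j)) := by
          simp only [α, β, List.map_append]
        rw [hlist]
        refine List.Nodup.map (fun j j' h => (Prod.ext_iff.1 h).2) ?_
        refine List.nodup_append'.2 ⟨Finset.nodup_toList _, Finset.nodup_toList _, ?_⟩
        intro j h1 h2
        rw [Finset.mem_toList] at h1 h2
        exact (Finset.mem_compl.1 h2) h1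
      rw [coeff_iterD_of_nodup _ hnd 0 (fun _ _ => rfl), zero_add, hword,
        Finset.sum_add_sum_compl, coeff_perPoly_rho]
    · rw [if_neg hpp]
      obtain ⟨K, hK⟩ := exists_coeff_iterD (R := ℂ) (α p ++ β p') 0
      rw [hK, zero_add, hword, coeff_perPoly_eq_zero, mul_zero]
      intro τ hτ
      by_cases hT : (p.2 : Finset (Fin n)) = p'.2
      · have hS : (p.1 : Finset (Fin n)) ≠ p'.1 := by
          intro hS
          exact hpp (Prod.ext (Subtype.ext hS) (Subtype.ext hT))
        obtain ⟨a₀, ha₀, ha₀'⟩ : ∃ a₀ ∈ (p.1 : Finset (Fin n)), a₀ ∉ (p'.1 : Finset (Fin n)) := by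
          by_contra hcon
          push Not at hcon
          exact hS (Finset.eq_of_subset_of_card_le hcon
            (by rw [hmemP p.1.2, hmemP p'.1.2]))
        have h1 : (π p).symm a₀ ∈ (p.2 : Finset (Fin n)) := by
          rw [← hπ p, Equiv.apply_symm_apply]; exact ha₀
        have h2 : (π p').symm a₀ ∈ (p'.2 : Finset (Fin n))ᶜ := by
          rw [Finset.mem_compl, ← hπ p', Equiv.apply_symm_apply]; exact ha₀'
        have key := congrArg (fun d : Fin n × Fin n →₀ ℕ => Finsupp.mapDomain Prod.fst d a₀) hτ
        rw [mapDomain_fst_rho, Finsupp.mapDomain_add, Finsupp.add_apply] at key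
        have l1 := one_le_mapDomain_fst_sum_single (π p) (p.2 : Finset (Fin n)) a₀ h1
        have l2 := one_le_mapDomain_fst_sum_single (π p') ((p'.2 : Finset (Fin n))ᶜ) a₀ h2
        omega
      · obtain ⟨j₀, hj₀, hj₀'⟩ : ∃ j₀ ∈ (p.2 : Finset (Fin n)), j₀ ∉ (p'.2 : Finset (Fin n)) := by
          by_contra hcon
          push Not at hcon
          exact hT (Finset.eq_of_subset_of_card_le hcon
            (by rw [hmemP p.2.2, hmemP p'.2.2]))
        have key := congrArg (fun d : Fin n × Fin n →₀ ℕ => Finsupp.mapDomain Prod.snd d j₀) hτ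
        rw [mapDomain_snd_rho, Finsupp.mapDomain_add, Finsupp.add_apply, mapDomain_snd_sum_single,
          mapDomain_snd_sum_single, if_pos hj₀, if_pos (Finset.mem_compl.2 hj₀')] at key
        omega
  have hαlen : ∀ p, (α p).length = k := by
    intro p
    simp only [α, List.length_map, Finset.length_toList, hmemP p.2.2]
  have hβlen : ∀ p, (β p).length = n - k := by
    intro p
    simp only [β, List.length_map, Finset.length_toList, Finset.card_compl, Fintype.card_fin,
      hmemP p.2.2]
  let e := Fintype.equivFin (P × P)
  refine ⟨Fintype.card (P × P), α ∘ e.symm, β ∘ e.symm, hcard, fun i => hαlen _, fun j => hβlen _,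
    ?_⟩
  have hsub : (Matrix.of fun i j => coeff 0 (((α ∘ e.symm) i ++ (β ∘ e.symm) j).foldr
      (fun v g => pderiv v g) (perPoly (Fin n) ℂ))) =
      (Matrix.of fun p p' => coeff 0 ((α p ++ β p').foldr (fun v g => pderiv v g)
        (perPoly (Fin n) ℂ))).submatrix e.symm e.symm := rfl
  rw [hsub, Matrix.det_submatrix_equiv_self, hM, Matrix.det_one]
  exact one_ne_zero

end PermMinor

/-! ## §5 The padded flattening inequality for border expressions of the permanent -/
section Main

variable {n r D q : ℕ}

/-- The right-hand side of the crux, `ε^q per_n + ε^(q+1) G`, is `ε^q · Q` with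
`Q = per_n + ε G` and `Q(0) = 1 · per_n`. -/
theorem borderTarget_eq (G : MvPolynomial (Fin n × Fin n) ℂ[X]) :
    C (Polynomial.X ^ q) * MvPolynomial.map Polynomial.C (perPoly (Fin n) ℂ) +
        C (Polynomial.X ^ (q + 1)) * G =
      C (Polynomial.X ^ q) * (MvPolynomial.map Polynomial.C (perPoly (Fin n) ℂ) +
        C Polynomial.X * G) := by
  rw [pow_succ, map_mul]
  ring

/-- `Q(0) = per_n` for `Q = per_n + ε G`. -/
theorem map_constantCoeff_target (G : MvPolynomial (Fin n × Fin n) ℂ[X]) :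
    MvPolynomial.map Polynomial.constantCoeff (MvPolynomial.map Polynomial.C (perPoly (Fin n) ℂ) +
        C Polynomial.X * G) = C 1 * perPoly (Fin n) ℂ := by
  rw [map_add, map_mul, map_C, Polynomial.constantCoeff_apply, Polynomial.coeff_X_zero, C_0, zero_mul,
    add_zero, map_map, C_1, one_mul]
  have hid : Polynomial.constantCoeff.comp Polynomial.C = RingHom.id ℂ := by
    ext x
    simp
  rw [hid, map_id]

/-- **Padded flattening inequality (border).**  A border `σ_r(Ch_D)`-expression
`Σ_{i<r} Π_{j<D} ℓ_ij(ε) = ε^q per_n + ε^(q+1) G` (affine `ℓ_ij` over `ℂ[ε]`) forces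
`C(n,k)² ≤ r · C(D,k)` for every `k ≤ n`. [cite: LandsbergGCT2017, §6.2, §7.2] -/
theorem choose_sq_le_mul_choose_of_border
    (ℓ : Fin r → Fin D → MvPolynomial (Fin n × Fin n) ℂ[X])
    (G : MvPolynomial (Fin n × Fin n) ℂ[X]) (hℓ : ∀ i j, (ℓ i j).totalDegree ≤ 1)
    (hsum : ∑ i, ∏ j, ℓ i j =
      C (Polynomial.X ^ q) * MvPolynomial.map Polynomial.C (perPoly (Fin n) ℂ) +
        C (Polynomial.X ^ (q + 1)) * G)
    (k : ℕ) (hk : k ≤ n) : (n.choose k) ^ 2 ≤ r * D.choose k := by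
  classical
  obtain ⟨N, α, β, hN, -, hβ, hdet⟩ := exists_perPoly_flattening_len n (n - k)
  rw [Nat.sub_sub_self hk] at hβ
  rw [Nat.choose_symm hk] at hN
  rw [borderTarget_eq] at hsum
  have h := card_le_of_border_chow ℓ hℓ _ (perPoly (Fin n) ℂ) 1 one_ne_zero hsum
    (map_constantCoeff_target G) α β k hβ hdet
  rwa [Fintype.card_fin, hN] at h

/-- **Registered form** (sub-goal `chowBorderBound_flatteningBound` of stmt-ValiantsHypothesis-5936):
the padded flattening inequality with all data explicit, in the crux's own spelling.
[cite: LandsbergGCT2017, §6.2, §7.2] -/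
theorem chowBorderBound_flatteningBound :
    ∀ (n r D q : ℕ) (ℓ : Fin r → Fin D → MvPolynomial (Fin n × Fin n) (Polynomial ℂ))
      (G : MvPolynomial (Fin n × Fin n) (Polynomial ℂ)),
      (∀ i j, (ℓ i j).totalDegree ≤ 1) →
      (∑ i, ∏ j, ℓ i j) =
        MvPolynomial.C (Polynomial.X ^ q) *
            MvPolynomial.map Polynomial.C
              (Literature.Computability.AlgebraicComplexity.perPoly (Fin n) ℂ) +
          MvPolynomial.C (Polynomial.X ^ (q + 1)) * G →
      ∀ k ≤ n, (n.choose k) ^ 2 ≤ r * D.choose k :=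
  fun _ _ _ _ ℓ G hℓ hsum k hk => choose_sq_le_mul_choose_of_border ℓ G hℓ hsum k hk

end Main

end Summit.ValiantsHypothesis.ValiantsHypothesis.Theorems.ChowBorderBound.PaddedFlattening

end
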